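import Summits.HodgeConjecture.HodgeConjecture.Theorems.HLiu418S1BettiSliceExclusion
import Summits.HodgeConjecture.HodgeConjecture.Theorems.HLiu418CurveHodgeTypesDisjoint
import Literature.NumberTheory.Automorphic.UnitaryCurveCotangentSpectralProjectionHerm
import Literature.NumberTheory.Rogawski1990.CurveThetaHodgeTypeSigned
import Literature.NumberTheory.Automorphic.IdeleClassCharacterConjugate
import Literature.NumberTheory.Rogawski1990.CurveThetaHodgeTypeNecessity   -- ED. 2 (#74R): the ORIENTED necessity letters E3nec₂-pos
import Summits.HodgeConjecture.HodgeConjecture.Theorems.F0AlbCmS1bSignedExclusion   -- `exists_locF_eq_epsOf`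
import Literature.NumberTheory.Automorphic.Liu2021.RemD5CompanionAdmissibility   -- `exists_isAdmissibleElement_neg_iff_bar`
import HarnessLib

/-!
# Crux `HLiu418`, line `F0_AlbCm` ∕ sub-sub-line `F0_AlbCmS1Betti` — the EXCLUSION STUB (X) FOLDED onto the ORIENTED necessity letters E3nec₂-pos
# (#74R, EDITION 2 of ★ `Rogawski1990/CurveThetaHodgeTypeNecessity`, ★ p848618) — PORT-3 of ★ `Theorems/HLiu418S1BettiSliceExclusionNec.lean` onto the re-lettered #74R

Floor-0 programme P5 (Alb-CM); crux item stmt-HodgeConjecture-24832 (`HCCMUnconditional.HLiu418`); seat LA1-p03 (g2) on LD2-plan (g0)'s port list (2026-09-02,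
LEAD ruling «LD-R1»: letter #74 `curveThetaHodgeTypeNecessity_hol` is MISSTATED — it omits the orientation binders `(hτt : 0 < (ι t).re) (hτt' : (ι t).im = 0)` of the
consumer `S1BettiShape` — and is RE-LETTERED as #74R `curveThetaHodgeTypeNecessity_hol_pos` ∕ `…_antihol_pos`).  THEOREMS ONLY, def-free, `sorry`-free;
`--supports stmt-HodgeConjecture-24832`, count-neutral.  HC_CM is proved only modulo the 7 printed citations until rung 0 closes.  = ★ `HLiu418S1BettiSliceExclusionNec.lean`
(F0P5-p02 (g4), «T3′») VERBATIM except: the two hypothesis types (E3nec₂ `curveThetaHodgeTypeNecessity_hol ∕ _antihol` ↦ E3nec₂-pos `…_hol_pos ∕ …_antihol_pos`) and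
the two letter applications `k₁` ∕ `k₂`, which now PASS the orientation binders `hτt hτt'` that the conclusion `S1ExclusionShape` already carries (`_hτt _hτt'` in the
statement; they were introduced but idle on the letter side in the ★ original).  Everything else — the `hadm'` derivation (★ `IsConjugateSymplectic.cmType_galConj`,
★ `Rep.locF_toFun` + ★ `exists_locF_eq_epsOf`, ★ `RemD5.exists_isAdmissibleElement_neg_iff_bar`), the junction J1′₂ twice, TP⁺ at the hermitian `σ_{w₁}J⋆`, and the
closing clash `k₁ hadm' : e♮ ∈ Φ_λ` (hol necessity at the `(1,0)` occurrence `P`) vs `k₂ hadm' : e♮ ∉ Φ_λ` (antihol necessity at the `(0,1)` occurrence `P′`) — is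
unchanged.  Conclusion = the TYPE of `stub_X : S1ExclusionShape` TOKEN FOR TOKEN (unchanged), so the `_pos` wrapper of ★ `F0AlbCmS1BettiHoldsSignedThetaNec` (PORT-5a)
re-feeds by name; the ★ unsigned original stays in the tree as settled content.

MATHEMATICS (as in the ★ twin).  [Liu2021, Rem. D.5] at the label `λ := μ ∘ c`, line `a := r ε` (so `ε_a = ε`, λ-admissible by `_hadm` and [Liu2021, Def. 4.12,
last sentence]): a `(1,0)`-type occurrence of `ω⋆_lab = ω(λ, ε_a, χ)_f ∘ (finAdelicCongr g⋆)⁻¹` forces `e♮ ∈ Φ_λ`, a `(0,1)`-type occurrence forces `e♮ ∉ Φ_λ`; a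
non-zero `ω⋆_lab`-intertwiner into `holCotForms₂ 𝔣` AND one into its conjugate image would produce both occurrences (★ `exists_discreteAutomorphicRep_not_orthogonal_hasFinComponent`,
(D₂) at hermitian `σ_{w(ι₁)}J⋆`), absurd.  E2′₂θ `curveThetaHodgeTypeRigid` at the crux label is thus a corollary of E3nec₂ alone.

References: [Liu2021] Camb. J. Math. 9 (2021): Rem. D.5 (p. 131); Prop. D.4 (1)–(2) and proof (p. 130–131); Lem. D.1; Def. 4.11–4.12.  [Rogawski1990] Ann. of Math. Stud. 123,
§11 (Prop. 11.1.1, 11.2.1, Thm. 11.5.1).  [HarrisKudlaSweet1996] Thm. 6.1.  [BorelJacquet1979] PSPM 33.1, §4.6.  [Borel1997] §5.14, Thm. 2.13.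
-/

-- ED. 2 (ROAD (i′) PHASE B, F0P5-plan 02:30:56Z): the two TP₂ letter applications go through ★ `….apply_herm` (F0P5-p03 (g2), p803625) at the
-- hermitian `σ_{w₁}J⋆` supplied by ★ `CurveHodgeTypesDisjoint.isHermitian_map_of_formCongr` from `hτt'`; statements byte-identical to ED. 1 (p800694).
set_option autoImplicit false
-- the mandated namespace repeats `HodgeConjecture.HodgeConjecture`, as in every `Theorems/*.lean` of this sub-problem
set_option linter.dupNamespace false

noncomputable section

namespace Summit.HodgeConjecture.HodgeConjecture.Cruxes.HLiu418.S1BettiSliceExclusionNecPos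

open scoped TensorProduct Matrix NumberField Kronecker ComplexOrder InnerProductSpace ENNReal
open MeasureTheory
open NumberField NumberField.InfinitePlace IsDedekindDomain
open Summit.HodgeConjecture.CorCM.Model Summit.HodgeConjecture.CorCM.Model.HComp Summit.HodgeConjecture.CorCM.HComp
open Literature.AlgebraicGeometry.Motives (CMType AbelianVariety)
open Literature.AlgebraicGeometry.ShimuraVarieties Literature.AlgebraicGeometry.ShimuraVarieties.UnitaryCanonicalModel
open Literature.NumberTheory.Automorphic Literature.NumberTheory.Automorphic.UnitaryGroup Literature.NumberTheory.Automorphic.UnitaryCurveForms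
open Literature.NumberTheory.Automorphic.UnitaryGroup.CotangentForms (toQuotFun toQuotFun_mk)
open Literature.NumberTheory.Automorphic.IdeleClassGroup Literature.NumberTheory.Automorphic.Liu2021 Literature.NumberTheory.Automorphic.Liu2021.AppendixC
open Literature.NumberTheory.GaloisRepresentations Literature.RepresentationTheory.Liu2021 Literature.RepresentationTheory.HarrisKudlaSweet1996
open Literature.AlgebraicGeometry.Liu2021 (IsAdmissibleElement)
open Literature.NumberTheory.Weil1964 Literature.NumberTheory.GelbartRogawski1991 Literature.NumberTheory.GelbartRogawski1991.UnitaryDualPair Literature.NumberTheory.GelbartRogawski1991.UnitaryDualPair.WeilCoinv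
open Literature.NumberTheory.GelbartRogawski1991.UnitaryDualPair.LocalSplitting
open Literature.NumberTheory.Automorphic.Liu2021.Def411WeilCarriersDoubling
open Literature.NumberTheory.Automorphic.Liu2021.Def411WeilCarriers (TW JW JW_eq isSymm_TW isUnit_det_TW Rep Eps epsOf Chi rhoVAtLine rhoAtLine omegaAtLine)
open Summit.HodgeConjecture.CorCM (CMField)
open Summit.HodgeConjecture.CorCM.Lines.A3Liu418
open Summit.HodgeConjecture.HodgeConjecture.Cruxes.H413.F0P3HilbertProjection
open Summit.HodgeConjecture.HodgeConjecture.Cruxes.H413.SpectrumJunction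
open Summit.HodgeConjecture.HodgeConjecture.Cruxes.HLiu418.ScalarSpectralJunction
open Summit.HodgeConjecture.HodgeConjecture.Cruxes.HLiu418.S1BettiSliceExclusion
open Summit.HodgeConjecture.HodgeConjecture.Cruxes.HLiu418.F0AlbCmS1bSignedExclusion (exists_locF_eq_epsOf)
open Literature.NumberTheory.Automorphic.Liu2021.RemD5 (exists_isAdmissibleElement_neg_iff_bar)
open Literature.NumberTheory.Automorphic.Liu2021.Def411WeilCarriers (locF)
open Literature.NumberTheory.ComplexMultiplication.CMTypeOps (bar)

set_option synthInstance.maxHeartbeats 400000 in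
set_option maxHeartbeats 4000000 in  -- both as the E2′ original (★ `stub_X_of_letters`): the `ω⋆_lab` term is elaborated many times
/-- **THE (X) FOLD ON THE ORIENTED NECESSITY LETTERS — `S1ExclusionShape` from E3nec₂-pos `curveThetaHodgeTypeNecessity_hol_pos ∕ _antihol_pos` (#74R, BY NAME,
consumed under `hadm'` AND the orientation `hτt hτt'` of the shape statement) INSTEAD OF the unsigned E3nec₂ letters (ruled misstated), plus TP⁺ (`hTPhol` ∕ `hTPantihol`, ★)
and the ★ continuity of holomorphic curve cotangent forms.**  Same conclusion as ★ `S1BettiSliceExclusionNec.stub_X_of_nec_letters` (F0P5-p02) and ★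
`S1BettiSliceExclusion.stub_X_of_letters` (F0P5-p03), TOKEN FOR TOKEN (= the TYPE of the sub-sub-line's `stub_X : S1ExclusionShape`); same proof over the same ★ helpers,
the two letter applications at the ONE label `χₕ := toHeckeCharacter F (galConj c μ)` — a conjugate-symplectic splitting (★ `hμ.galConj`) of weight one (★
`HasWeight.galConj_complexConj`) — now for the ORIENTED `H = t⁻¹·g⋆*(diag dJ)g⋆` (`0 < (ι₁ t).re`, `(ι₁ t).im = 0`, the shape's own binders): the `(1,0)` occurrence
gives `e♮ ∈ Φ_λ`, the `(0,1)` occurrence gives `e♮ ∉ Φ_λ`, contradiction.  Port of ★ `stub_X_of_nec_letters` onto #74R.  HC_CM is proved only modulo the 7 printed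
citations until rung 0 closes.
[cite: Liu2021, Rem. D.5 (p. 131); Prop. D.4 (1)–(2) and proof (p. 130–131)] [cite: Rogawski1990, §11.1 Prop. 11.1.1; Prop. 11.2.1 (b); Thm. 11.5.1 (b)]
[cite: BorelJacquet1979, §4.6] -/
theorem stub_X_of_nec_letters_pos (hE3hol : Literature.NumberTheory.Rogawski1990.curveThetaHodgeTypeNecessity_hol_pos)
    (hE3antihol : Literature.NumberTheory.Rogawski1990.curveThetaHodgeTypeNecessity_antihol_pos)
    (hTPhol : Literature.NumberTheory.Automorphic.UnitaryCurveForms.holCotFormSpectralProjection₂)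
    (hTPantihol : Literature.NumberTheory.Automorphic.UnitaryCurveForms.antiholCotFormSpectralProjection₂) :
      ∀ (F : CMField) [IsGalois ℚ F] (ι₁ : F →+* ℂ)
        (μ : Literature.NumberTheory.Automorphic.IdeleClassGroup (F : Type) →ₜ* Circle)
        (hμ : IdeleClassGroup.IsConjugateSymplectic (F : Type) μ)
        (_hw : IdeleClassGroup.HasWeight (F : Type) μ 1)
        (Jstar : Matrix (Fin 2) (Fin 2) (F : Type)) (t : (F : Type)) (ht : t ≠ 0) (_hτt : 0 < (ι₁ t).re) (_hτt' : (ι₁ t).im = 0)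
        (gstar : GL (Fin 2) (F : Type))
        (dJ : Fin 2 → (F : Type)) (hdJ : ∀ i, IsCMField.complexConj (F : Type) (dJ i) = dJ i) (hdJ0 : ∀ i, dJ i ≠ 0)
        (hg : formCongr ((IsCMField.complexConj (F : Type) : (F : Type) ≃ₐ[↥(maximalRealSubfield (F : Type))] (F : Type)) :
            (F : Type) →+* (F : Type)) gstar (t • Jstar) = Matrix.diagonal dJ)
        (_hsig : (∃ Tstar : GL (Fin 2) ℂ,
            formCongr (starRingEnd ℂ) Tstar ((Matrix.diagonal dJ).map ι₁) = Matrix.diagonal ![(1 : ℂ), -1]) ∧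
          ∀ τ' : (F : Type) →+* ℂ, InfinitePlace.mk τ' ≠ InfinitePlace.mk ι₁ → ((Matrix.diagonal dJ).map τ').PosDef)
        (h4 : 4 ≤ Module.finrank ℚ (F : Type))
        (r : Rep ↥(maximalRealSubfield (F : Type)) (imagUnitSq F))
        (ε : Eps ↥(maximalRealSubfield (F : Type)) (imagUnitSq F))
        (_hadm : ∃ e : (F : Type), IsAdmissibleElement (F : Type) hμ.cmType.1 e ∧
          epsOf ↥(maximalRealSubfield (F : Type)) (imagUnitSq F) (F : Type) (2 * imagUnit (F : Type))⁻¹ (-e) = ε)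
        (χ : Chi ↥(maximalRealSubfield (F : Type)) (F : Type) (IsCMField.complexConj (F : Type)))
        (𝔣 : ConeFrame (F : Type) Jstar (cmPlace (F : Type) ι₁)),
        (∀ ψ : Representation.IntertwiningMap
            ((rhoVAtLine ↥(maximalRealSubfield (F : Type)) (F : Type) (IsCMField.complexConj (F : Type)) 2
              (finProdFinEquiv : Fin 2 × Fin 1 ≃ Fin (2 * 1)) (Matrix.diagonal dJ)
              (complexConj_imagUnit F) (imagUnit_ne_zero F) (imagUnit_mul_self F) (realDiagonal_isSymm F dJ hdJ)
              (isUnit_det_realDiagonal F dJ hdJ hdJ0) (realDiagonal_map F dJ hdJ).symm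
              (hsChiGS F finProdFinEquiv dJ hdJ hdJ0
                (toHeckeCharacter (F : Type) (galConj (IsCMField.complexConj (F : Type)) μ))
                (isUnitary_toHeckeCharacter (F : Type) (galConj (IsCMField.complexConj (F : Type)) μ))
                ((isOscillatorChar_toHeckeCharacter_iff (galConj (IsCMField.complexConj (F : Type)) μ)).mpr hμ.galConj))
              (r.toFun ε) χ).comp
              (finAdelicCongr ↥(maximalRealSubfield (F : Type)) (F : Type) (IsCMField.complexConj (F : Type)) gstar ht hg).symm.toMonoidHom)
            (rightRep₂ ↥(maximalRealSubfield (F : Type)) (F : Type) (IsCMField.complexConj (F : Type)) Jstar),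
          (∀ w, ψ w ∈ holCotForms₂ ↥(maximalRealSubfield (F : Type)) (F : Type) (IsCMField.complexConj (F : Type)) Jstar
              (IsCMField.complexConj_ne_one (F : Type)) (UnitaryGroup.complexConj_smul_infinitePlace (F : Type))
              (cmPlace (F : Type) ι₁) 𝔣) → ψ = 0) ∨
        (∀ ψ : Representation.IntertwiningMap
            ((rhoVAtLine ↥(maximalRealSubfield (F : Type)) (F : Type) (IsCMField.complexConj (F : Type)) 2
              (finProdFinEquiv : Fin 2 × Fin 1 ≃ Fin (2 * 1)) (Matrix.diagonal dJ)
              (complexConj_imagUnit F) (imagUnit_ne_zero F) (imagUnit_mul_self F) (realDiagonal_isSymm F dJ hdJ)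
              (isUnit_det_realDiagonal F dJ hdJ hdJ0) (realDiagonal_map F dJ hdJ).symm
              (hsChiGS F finProdFinEquiv dJ hdJ hdJ0
                (toHeckeCharacter (F : Type) (galConj (IsCMField.complexConj (F : Type)) μ))
                (isUnitary_toHeckeCharacter (F : Type) (galConj (IsCMField.complexConj (F : Type)) μ))
                ((isOscillatorChar_toHeckeCharacter_iff (galConj (IsCMField.complexConj (F : Type)) μ)).mpr hμ.galConj))
              (r.toFun ε) χ).comp
              (finAdelicCongr ↥(maximalRealSubfield (F : Type)) (F : Type) (IsCMField.complexConj (F : Type)) gstar ht hg).symm.toMonoidHom)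
            (rightRep₂ ↥(maximalRealSubfield (F : Type)) (F : Type) (IsCMField.complexConj (F : Type)) Jstar),
          (∀ w, ψ w ∈ (holCotForms₂ ↥(maximalRealSubfield (F : Type)) (F : Type) (IsCMField.complexConj (F : Type)) Jstar
              (IsCMField.complexConj_ne_one (F : Type)) (UnitaryGroup.complexConj_smul_infinitePlace (F : Type))
              (cmPlace (F : Type) ι₁) 𝔣).map (conjFun₂ ↥(maximalRealSubfield (F : Type)) (F : Type) (IsCMField.complexConj (F : Type)) Jstar)) → ψ = 0) := by
  intro F _ ι₁ μ hμ hw Jstar t ht hτt hτt' gstar dJ hdJ hdJ0 hg hsig h4 r ε hadm χ 𝔣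
  by_contra hcon
  rw [not_or] at hcon
  obtain ⟨hA, hB⟩ := hcon
  push Not at hA hB
  obtain ⟨ψ, hψv, hψ0⟩ := hA
  obtain ⟨ψ', hψ'v, hψ'0⟩ := hB
  -- `J⋆` anisotropic ⇒ an automorphic measure with COMPACT quotient and discretely decomposable `L²`
  obtain ⟨τ, hτ⟩ := UnitaryGroup.exists_infinitePlace_ne (F : Type) h4 ι₁
  have hanis := anisotropic_of_formCongr_posDef (F : Type) Jstar t gstar dJ hg τ (hsig.2 τ hτ)
  obtain ⟨μA, hμA, hdisc⟩ :=
    UnitaryGroup.exists_isAutomorphicMeasure_isDiscretelyDecomposable_adelicGroupData (F : Type) 2 Jstar hanis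
  haveI := hμA
  haveI : CompactSpace (adelicGroupData ↥(maximalRealSubfield (F : Type)) (F : Type) (IsCMField.complexConj (F : Type)) 2 Jstar).automorphicQuotient :=
    UnitaryGroup.compactSpace_cmDatum_automorphicQuotient (F : Type) 2 Jstar hanis
  -- `ω⋆_lab ≠ 0` (as `ψ ≠ 0`), hence irreducible (★ irreducible-or-zero), and smooth (★)
  obtain ⟨w₁, hw₁⟩ : ∃ w, ψ w ≠ 0 := by
    by_contra h
    push Not at h
    exact hψ0 (Representation.IntertwiningMap.ext (LinearMap.ext h))
  haveI hnt : Nontrivial _ := ⟨⟨w₁, 0, fun h => hw₁ (by rw [h, map_zero])⟩⟩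
  have hirr := (subsingleton_or_isIrreducible_omegaStarGS F dJ hdJ hdJ0
    (toHeckeCharacter (F : Type) (galConj (IsCMField.complexConj (F : Type)) μ))
    (isUnitary_toHeckeCharacter (F : Type) (galConj (IsCMField.complexConj (F : Type)) μ))
    ((isOscillatorChar_toHeckeCharacter_iff (galConj (IsCMField.complexConj (F : Type)) μ)).mpr hμ.galConj)
    (r.toFun ε) χ ht gstar hg).resolve_left (not_subsingleton _)
  have hsmR := isSmoothRep_omegaStarGS F dJ hdJ hdJ0
    (toHeckeCharacter (F : Type) (galConj (IsCMField.complexConj (F : Type)) μ))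
    (isUnitary_toHeckeCharacter (F : Type) (galConj (IsCMField.complexConj (F : Type)) μ))
    ((isOscillatorChar_toHeckeCharacter_iff (galConj (IsCMField.complexConj (F : Type)) μ)).mpr hμ.galConj)
    (r.toFun ε) χ ht gstar hg
  have hsm : Representation.IsSmooth
      ((rhoVAtLine ↥(maximalRealSubfield (F : Type)) (F : Type) (IsCMField.complexConj (F : Type)) 2
          (finProdFinEquiv : Fin 2 × Fin 1 ≃ Fin (2 * 1)) (Matrix.diagonal dJ)
          (complexConj_imagUnit F) (imagUnit_ne_zero F) (imagUnit_mul_self F) (realDiagonal_isSymm F dJ hdJ)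
          (isUnit_det_realDiagonal F dJ hdJ hdJ0) (realDiagonal_map F dJ hdJ).symm
          (hsChiGS F finProdFinEquiv dJ hdJ hdJ0
            (toHeckeCharacter (F : Type) (galConj (IsCMField.complexConj (F : Type)) μ))
            (isUnitary_toHeckeCharacter (F : Type) (galConj (IsCMField.complexConj (F : Type)) μ))
            ((isOscillatorChar_toHeckeCharacter_iff (galConj (IsCMField.complexConj (F : Type)) μ)).mpr hμ.galConj))
          (r.toFun ε) χ).comp
          (finAdelicCongr ↥(maximalRealSubfield (F : Type)) (F : Type) (IsCMField.complexConj (F : Type)) gstar ht hg).symm.toMonoidHom) :=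
    fun v => by
      obtain ⟨S, hS, hfixv⟩ := hsmR v
      exact Representation.isSmoothVector_of_le _ hS fun k hk => hfixv k hk
  -- continuity hypotheses at this frame
  have hcontA : ∀ f ∈ holCotForms₂ ↥(maximalRealSubfield (F : Type)) (F : Type) (IsCMField.complexConj (F : Type)) Jstar
      (IsCMField.complexConj_ne_one (F : Type)) (UnitaryGroup.complexConj_smul_infinitePlace (F : Type)) (cmPlace (F : Type) ι₁) 𝔣,
      Continuous f := fun f hf => continuous_of_mem_holCotForms₂ _ _ _ _ _ _ _ 𝔣 hf
  -- the junction J1′₂, twice (same `μA`)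
  obtain ⟨P, w, h, hu, hfin⟩ := exists_discreteAutomorphicRep_not_orthogonal_hasFinComponent (μ := μA) hdisc _ hirr ψ.toLinearMap
    (fun g w x => by
      show ψ (_) x = ψ w _
      rw [Representation.IntertwiningMap.isIntertwining]
      rfl)
    (fun w => leftInvariant_of_mem_holCotForms₂ (hψv w)) (fun w => hcontA (ψ w) (hψv w))
    (fun h0 => hψ0 (Representation.IntertwiningMap.ext h0))
  obtain ⟨P', w', h', hu', hfin'⟩ := exists_discreteAutomorphicRep_not_orthogonal_hasFinComponent (μ := μA) hdisc _ hirr ψ'.toLinearMap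
    (fun g w x => by
      show ψ' (_) x = ψ' w _
      rw [Representation.IntertwiningMap.isIntertwining]
      rfl)
    (fun w => leftInvariant_of_mem_map_conjFun₂ (hψ'v w)) (fun w => continuous_of_mem_map_conjFun₂ _ _ _ _ _ _ _ 𝔣 (hψ'v w))
    (fun h0 => hψ'0 (Representation.IntertwiningMap.ext h0))
  -- TP⁺: `P` is of type (1,0), `P′` of type (0,1)
  obtain ⟨f₁, hf₁, hf₁L, heq₁⟩ := hTPhol.apply_herm (F : Type) ι₁ Jstar dJ hdJ hdJ0 t ht gstar hg
    (CurveHodgeTypesDisjoint.isHermitian_map_of_formCongr (F : Type) ι₁ Jstar t ht hτt' gstar dJ hdJ hg _) hsig.1 hsig.2 h4 𝔣 μA P (ψ w) (hψv w) h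
  obtain ⟨f₂, hf₂, hf₂L, heq₂⟩ := hTPantihol.apply_herm (F : Type) ι₁ Jstar dJ hdJ hdJ0 t ht gstar hg
    (CurveHodgeTypesDisjoint.isHermitian_map_of_formCongr (F : Type) ι₁ Jstar t ht hτt' gstar dJ hdJ hg _) hsig.1 hsig.2 h4 𝔣 μA P' (ψ' w') (hψ'v w') h'
  have hne₁ : MemLp.toLp (toQuotFun _ f₁) hf₁L ≠ 0 := by
    rw [← heq₁, Submodule.starProjection_apply]
    exact Subtype.coe_ne_coe.mpr (orthogonalProjectionOnto_ne_zero P.space hu)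
  have hne₂ : MemLp.toLp (toQuotFun _ f₂) hf₂L ≠ 0 := by
    rw [← heq₂, Submodule.starProjection_apply]
    exact Subtype.coe_ne_coe.mpr (orthogonalProjectionOnto_ne_zero P'.space hu')
  have hP : ∃ f ∈ holCotForms₂ ↥(maximalRealSubfield (F : Type)) (F : Type) (IsCMField.complexConj (F : Type)) Jstar
      (IsCMField.complexConj_ne_one (F : Type)) (UnitaryGroup.complexConj_smul_infinitePlace (F : Type)) (cmPlace (F : Type) ι₁) 𝔣,
      f ≠ 0 ∧ ∃ hh : MemLp (toQuotFun _ f) 2 μA, MemLp.toLp (toQuotFun _ f) hh ∈ P.space.toSubmodule := by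
    refine ⟨f₁, hf₁, ?_, hf₁L, ?_⟩
    · rintro rfl
      exact hne₁ (MemLp.toLp_zero hf₁L)
    · rw [← heq₁]
      exact Submodule.starProjection_apply_mem _ _
  have hP' : ∃ f ∈ (holCotForms₂ ↥(maximalRealSubfield (F : Type)) (F : Type) (IsCMField.complexConj (F : Type)) Jstar
      (IsCMField.complexConj_ne_one (F : Type)) (UnitaryGroup.complexConj_smul_infinitePlace (F : Type)) (cmPlace (F : Type) ι₁) 𝔣).map
      (conjFun₂ ↥(maximalRealSubfield (F : Type)) (F : Type) (IsCMField.complexConj (F : Type)) Jstar),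
      f ≠ 0 ∧ ∃ hh : MemLp (toQuotFun _ f) 2 μA, MemLp.toLp (toQuotFun _ f) hh ∈ P'.space.toSubmodule := by
    refine ⟨f₂, hf₂, ?_, hf₂L, ?_⟩
    · rintro rfl
      exact hne₂ (MemLp.toLp_zero hf₂L)
    · rw [← heq₂]
      exact Submodule.starProjection_apply_mem _ _
  -- the two NECESSITY letters E3nec₂ at the label `λ := galConj c μ` (conjugate symplectic ★ `hμ.galConj`, weight one ★ `HasWeight.galConj_complexConj`),
  -- `(σ, ιV, j) := (ω⋆_lab, (finAdelicCongr g⋆)⁻¹, id)`, with `ε_a` λ-admissible (`hadm'`): the `(1,0)` occurrence `P` gives `e♮ ∈ Φ_λ`, the `(0,1)`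
  -- occurrence `P′` gives `e♮ ∉ Φ_λ` — jointly absurd
  have hwc : HasWeight (F : Type) (galConj (IsCMField.complexConj (F : Type)) μ) 1 := hw.galConj_complexConj
  -- T3′: the λ-admissibility of `ε_a` at `λ := μ ∘ c`, `a := r ε` (from `_hadm`; the three lines of ★ `F0AlbCmS1bSignedExclusion` :275–283)
  have hbar : hμ.galConj.cmType = bar hμ.cmType := hμ.cmType_galConj
  have hlocF : locF ↥(maximalRealSubfield (F : Type)) (imagUnitSq F) (r.toFun ε) = ε := by
    obtain ⟨e, -, he⟩ := hadm
    exact r.locF_toFun ε (he ▸ exists_locF_eq_epsOf _ _ _ _ _)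
  have hadm' : ∃ e : (F : Type), IsAdmissibleElement (F : Type) hμ.galConj.cmType.1 e ∧
      epsOf ↥(maximalRealSubfield (F : Type)) (imagUnitSq F) (F : Type) (2 * imagUnit (F : Type))⁻¹ e =
        locF ↥(maximalRealSubfield (F : Type)) (imagUnitSq F) (r.toFun ε) := by
    rw [hbar, hlocF]
    exact (exists_isAdmissibleElement_neg_iff_bar hμ.cmType (imagUnitSq F) (2 * imagUnit (F : Type))⁻¹ ε).1 hadm
  have k₁ := hE3hol (F : Type) ι₁ Jstar dJ hdJ hdJ0 t ht hτt hτt' gstar hg hsig.1 hsig.2 h4 𝔣 μA finProdFinEquiv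
    (galConj (IsCMField.complexConj (F : Type)) μ) hμ.galConj hwc (r.toFun ε) χ _ _ hirr hsm
    ⟨LinearMap.id, fun _ => rfl⟩ (fun _ _ hxy => hxy) P hP hfin
  have k₂ := hE3antihol (F : Type) ι₁ Jstar dJ hdJ hdJ0 t ht hτt hτt' gstar hg hsig.1 hsig.2 h4 𝔣 μA finProdFinEquiv
    (galConj (IsCMField.complexConj (F : Type)) μ) hμ.galConj hwc (r.toFun ε) χ _ _ hirr hsm
    ⟨LinearMap.id, fun _ => rfl⟩ (fun _ _ hxy => hxy) P' hP' hfin'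
  exact (k₂ hadm') (k₁ hadm')

end Summit.HodgeConjecture.HodgeConjecture.Cruxes.HLiu418.S1BettiSliceExclusionNecPos

end
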